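import Summits.CriticalPhenomena.PercolationContinuityZ3.Theorems.SahiMasterFamilySandwich

/-!
# The order-four step of the master conjecture WITHOUT Kahn: `E_4 ≥ 0` and (EQ-4) on quadruples with a `Z_3` sub-triple

Unit `prim-master-conj` (crux anchor stmt-CriticalPhenomena-4575).  `SahiMasterFamilyHeredity.lean` proves the step
"`U_{−m} ∈ Z_{k−1} ⇒ E_k(U) ≥ 0 ∧ (E_k(U) = 0 ↔ U ∈ Z_k)`" only GIVEN the order-`k − 1` master statements, so at
`k = 4` it needs Kahn's Conjecture 5 and (EQ-3).  This file proves the `k = 4` step UNCONDITIONALLY, from an exact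
identity.  For increasing events `X, Y, G, D` with `(X, Y, G) ∈ Z_3` via the pair `(X, Y)` (`ZVia X Y G`) let
`K = {ω | ω ∪ (esupp X ∪ esupp Y) ∈ G}` be the forced-open hull (`SahiMasterFamilySandwich.lean`: `G ⊆ K`,
`X ∩ G = X ∩ K`, `Y ∩ G = Y ∩ K`, `K` independent of `X`, `Y`, `X ∩ Y`).  Then for every product measure
(`sahiE_four_eq_of_zVia`)

  `E_4(G, D, X, Y) = 2·[Cov(X, KDY) + Cov(Y, KDX) + Cov(K, DXY)] + (P(K) − P(G))·[Cov(DX, Y) + Cov(X, DY)]`,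

five Harris-nonnegative terms; equivalently `E_4(X,Y,G,D) = E_4(X,Y,K,D) + P(K ∖ G)·E_3(X,Y,D)`, where the frame
`(X, Y, K)` is mutually independent, so that `E_4(X,Y,K,D) = 2Σ_j Cov(·, D ∩ others)` is the tree's independent-frame
identity (`Literature.Combinatorics.Sahi2008.sahiE_eq_sum_cov_of_indepMoments`, events form
`Literature.Probability.LatticeModels.sahiE4_eq_of_indep₃`; here re-derived by `ring` from the fifteen-term form).
The new content is the sandwich reduction.  Consequences (every `p ∈ [0,1]^ι`, resp. `p` in the open cube):
* `sahiE_four_ind_nonneg_of_zeroFlagTriple` — **Sahi's `E_4 ≥ 0` holds for every quadruple of increasing events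
  containing a `Z_3` sub-triple** (the order-4 analogue of `sahiE_three_ind_nonneg_of_indepPair`);
* `sahiE_four_ind_eq_zero_iff_of_zeroFlagTriple` — for such quadruples `E_4(μ_p) = 0 ↔ U ∈ Z_4` (pointwise (EQ-4));
* `masterFamilyEqIff_four_iff` — `MasterFamilyEqIff 4` is equivalent to "an interior zero of `E_4` forces a `Z_3`
  sub-triple"; `masterFamilyIdentEqIff_four_iff` — (EQI-4) is equivalent to **(T₄)**: four increasing events with NO
  `Z_3` sub-triple have `E_4(μ_p) ≠ 0` for some interior `p` (the exact analogue of (T) one order up).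
No conjecture is asserted; axioms standard. [this work]
-/

noncomputable section

open scoped Classical

namespace Summit.CriticalPhenomena.PercolationContinuityZ3.Theorems

open Finset Function MeasureTheory
open Literature.Combinatorics.Sahi2008
open Literature.Probability.Percolation (DeterminedBy determinedBy_iff)
open Literature.Probability.LatticeModels (prodBernoulli sahiE4 sahiE4_def prodBernoulli_harris)
open Literature.Probability.LatticeModels.Kahn2022 (Affects real_inter_eq_mul_of_forall_not_affects
  real_mul_real_lt_real_inter_of_affects real_pos_of_nonempty)
open Literature.Probability.Percolation.DecisionTree (ind)

section Core

variable {ι : Type*} [Fintype ι]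

/-- **The order-four identity on a `Z_3` sub-triple.**  For increasing `X, Y, G, D` with `ZVia X Y G`, `X, Y`
nonempty, and the forced-open hull `K`,
`E_4(G,D,X,Y) = 2[(P(KDXY) − P(X)P(KDY)) + (P(KDXY) − P(Y)P(KDX)) + (P(KDXY) − P(K)P(DXY))]
  + (P(K) − P(G))[(P(DXY) − P(DX)P(Y)) + (P(DXY) − P(X)P(DY))]`. [this work] -/
theorem sahiE_four_eq_of_zVia (p : ι → unitInterval) {X Y G : Set (Set ι)} (D : Set (Set ι)) (hX : IsUpperSet X)
    (hY : IsUpperSet Y) (hG : IsUpperSet G) (hXne : X.Nonempty) (hYne : Y.Nonempty) (hZ : ZVia X Y G)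
    (K : Set (Set ι)) (hK : K = {ω : Set ι | ω ∪ ↑(esupp X ∪ esupp Y) ∈ G}) :
    sahiE (bernoulliWeight p) 4 ![ind G, ind D, ind X, ind Y] =
      2 * (((prodBernoulli p).real (K ∩ D ∩ X ∩ Y) - (prodBernoulli p).real X * (prodBernoulli p).real (K ∩ D ∩ Y))
        + ((prodBernoulli p).real (K ∩ D ∩ X ∩ Y) - (prodBernoulli p).real Y * (prodBernoulli p).real (K ∩ D ∩ X))
        + ((prodBernoulli p).real (K ∩ D ∩ X ∩ Y) - (prodBernoulli p).real K * (prodBernoulli p).real (D ∩ X ∩ Y)))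
      + ((prodBernoulli p).real K - (prodBernoulli p).real G) *
        (((prodBernoulli p).real (D ∩ X ∩ Y) - (prodBernoulli p).real (D ∩ X) * (prodBernoulli p).real Y)
          + ((prodBernoulli p).real (D ∩ X ∩ Y) - (prodBernoulli p).real X * (prodBernoulli p).real (D ∩ Y))) := by
  have hXG : X ∩ G = X ∩ K := hK ▸ sandwich_left hX hY hG hYne hZ
  have hYG : Y ∩ G = Y ∩ K := hK ▸ sandwich_right hX hY hG hXne hZ
  have hKu : IsUpperSet K := hK ▸ isUpperSet_forcedHull hG _
  have hmem : ∀ ω, ω ∈ X ∨ ω ∈ Y → (ω ∈ G ↔ ω ∈ K) := by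
    rintro ω (hω | hω)
    · have := Set.ext_iff.1 hXG ω
      simp only [Set.mem_inter_iff] at this
      exact ⟨fun h => (this.1 ⟨hω, h⟩).2, fun h => (this.2 ⟨hω, h⟩).2⟩
    · have := Set.ext_iff.1 hYG ω
      simp only [Set.mem_inter_iff] at this
      exact ⟨fun h => (this.1 ⟨hω, h⟩).2, fun h => (this.2 ⟨hω, h⟩).2⟩
  -- set bookkeeping: every intersection of `G` with `X` or `Y` is the same intersection with `K`
  have c1 : G ∩ D ∩ X ∩ Y = K ∩ D ∩ X ∩ Y := by
    ext ω; have := hmem ω; simp only [Set.mem_inter_iff]; tauto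
  have c2 : G ∩ X ∩ Y = (X ∩ Y) ∩ K := by
    ext ω; have := hmem ω; simp only [Set.mem_inter_iff]; tauto
  have c3 : G ∩ D ∩ Y = K ∩ D ∩ Y := by
    ext ω; have := hmem ω; simp only [Set.mem_inter_iff]; tauto
  have c4 : G ∩ D ∩ X = K ∩ D ∩ X := by
    ext ω; have := hmem ω; simp only [Set.mem_inter_iff]; tauto
  have c5 : G ∩ Y = Y ∩ K := by
    ext ω; have := hmem ω; simp only [Set.mem_inter_iff]; tauto
  have c6 : G ∩ X = X ∩ K := by
    ext ω; have := hmem ω; simp only [Set.mem_inter_iff]; tauto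
  have dXY : Disjoint (esupp X) (esupp Y) := (suppZeroFlag_two_iff hX hY).1 hZ.1
  have iXY : (prodBernoulli p).real (X ∩ Y) = (prodBernoulli p).real X * (prodBernoulli p).real Y :=
    real_inter_eq_mul_of_forall_not_affects p hX hY fun i hiX hiY =>
      Finset.disjoint_left.1 dXY (mem_esupp.2 hiX) (mem_esupp.2 hiY)
  have iXK : (prodBernoulli p).real (X ∩ K) = (prodBernoulli p).real X * (prodBernoulli p).real K :=
    real_inter_eq_mul_of_forall_not_affects p hX hKu (hK ▸ forall_not_affects_forcedHull_left X Y G)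
  have iYK : (prodBernoulli p).real (Y ∩ K) = (prodBernoulli p).real Y * (prodBernoulli p).real K :=
    real_inter_eq_mul_of_forall_not_affects p hY hKu (hK ▸ forall_not_affects_forcedHull_right X Y G)
  have iXYK : (prodBernoulli p).real ((X ∩ Y) ∩ K) =
      (prodBernoulli p).real X * (prodBernoulli p).real Y * (prodBernoulli p).real K := by
    rw [real_inter_eq_mul_of_forall_not_affects p (hX.inter hY) hKu
      (hK ▸ forall_not_affects_forcedHull_inter X Y G), iXY]
  rw [sahiE_four_ind, sahiE4_def, c1, c2, c3, c4, c5, c6, iXY, iXK, iYK, iXYK]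
  ring

/-- **Nonnegativity on a `Z_3` sub-triple (named form, nonempty `X, Y`)**: `0 ≤ E_4(G,D,X,Y)`. [this work] -/
theorem sahiE_four_nonneg_of_zVia (p : ι → unitInterval) {X Y G : Set (Set ι)} (D : Set (Set ι)) (hX : IsUpperSet X)
    (hY : IsUpperSet Y) (hG : IsUpperSet G) (hD : IsUpperSet D) (hXne : X.Nonempty) (hYne : Y.Nonempty)
    (hZ : ZVia X Y G) : 0 ≤ sahiE (bernoulliWeight p) 4 ![ind G, ind D, ind X, ind Y] := by
  set K : Set (Set ι) := {ω : Set ι | ω ∪ ↑(esupp X ∪ esupp Y) ∈ G} with hK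
  have hKu : IsUpperSet K := isUpperSet_forcedHull hG _
  rw [sahiE_four_eq_of_zVia p D hX hY hG hXne hYne hZ K hK]
  have m := fun (A : Set (Set ι)) => (MeasurableSet.of_discrete : MeasurableSet A)
  have e1 : X ∩ (K ∩ D ∩ Y) = K ∩ D ∩ X ∩ Y := by ext ω; simp only [Set.mem_inter_iff]; tauto
  have e2 : Y ∩ (K ∩ D ∩ X) = K ∩ D ∩ X ∩ Y := by ext ω; simp only [Set.mem_inter_iff]; tauto
  have e3 : K ∩ (D ∩ X ∩ Y) = K ∩ D ∩ X ∩ Y := by ext ω; simp only [Set.mem_inter_iff]; tauto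
  have e5 : X ∩ (D ∩ Y) = D ∩ X ∩ Y := by ext ω; simp only [Set.mem_inter_iff]; tauto
  have t1 := prodBernoulli_harris p hX ((hKu.inter hD).inter hY) (m _) (m _)
  have t2 := prodBernoulli_harris p hY ((hKu.inter hD).inter hX) (m _) (m _)
  have t3 := prodBernoulli_harris p hKu ((hD.inter hX).inter hY) (m _) (m _)
  have t5 := prodBernoulli_harris p (hD.inter hX) hY (m _) (m _)
  have t6 := prodBernoulli_harris p hX (hD.inter hY) (m _) (m _)
  rw [e1] at t1; rw [e2] at t2; rw [e3] at t3; rw [e5] at t6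
  have t4 : (prodBernoulli p).real G ≤ (prodBernoulli p).real K := measureReal_mono (subset_forcedHull hG _)
  have hP : 0 ≤ ((prodBernoulli p).real K - (prodBernoulli p).real G) *
      (((prodBernoulli p).real (D ∩ X ∩ Y) - (prodBernoulli p).real (D ∩ X) * (prodBernoulli p).real Y)
        + ((prodBernoulli p).real (D ∩ X ∩ Y) - (prodBernoulli p).real X * (prodBernoulli p).real (D ∩ Y))) :=
    mul_nonneg (by linarith) (by linarith)
  linarith

/-- `Cov(A, B) = 0` under an interior product measure forces disjoint essential supports (strict Harris).
[this work] -/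
theorem disjoint_esupp_of_real_inter_eq (p : ι → unitInterval) (hp : ∀ e, (p e : ℝ) ∈ Set.Ioo (0 : ℝ) 1)
    {A B : Set (Set ι)} (hA : IsUpperSet A) (hB : IsUpperSet B)
    (h : (prodBernoulli p).real (A ∩ B) = (prodBernoulli p).real A * (prodBernoulli p).real B) :
    Disjoint (esupp A) (esupp B) := by
  rw [Finset.disjoint_left]
  intro i hiA hiB
  have := real_mul_real_lt_real_inter_of_affects p (fun e => Set.mem_Ioo.1 (hp e)) hA hB (mem_esupp.1 hiA)
    (mem_esupp.1 hiB)
  linarith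

/-- **The zero case on a `Z_3` sub-triple (named form)**: in the open cube, `E_4(G,D,X,Y) = 0` forces the four
support conditions (i) `X ⟂ Y∩G∩D`, (ii) `Y ⟂ X∩G∩D`, (iii) `K ⟂ X∩Y∩D`, (iv) `K = G` or
(`X∩D ⟂ Y` and `X ⟂ Y∩D`). [this work] -/
theorem supports_of_sahiE_four_eq_zero (p : ι → unitInterval) (hp : ∀ e, (p e : ℝ) ∈ Set.Ioo (0 : ℝ) 1)
    {X Y G D : Set (Set ι)} (hX : IsUpperSet X) (hY : IsUpperSet Y) (hG : IsUpperSet G) (hD : IsUpperSet D)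
    (hXne : X.Nonempty) (hYne : Y.Nonempty) (hZ : ZVia X Y G) (K : Set (Set ι))
    (hK : K = {ω : Set ι | ω ∪ ↑(esupp X ∪ esupp Y) ∈ G})
    (h0 : sahiE (bernoulliWeight p) 4 ![ind G, ind D, ind X, ind Y] = 0) :
    Disjoint (esupp X) (esupp (Y ∩ G ∩ D)) ∧ Disjoint (esupp Y) (esupp (X ∩ G ∩ D)) ∧
      Disjoint (esupp K) (esupp (X ∩ Y ∩ D)) ∧
      (K = G ∨ (Disjoint (esupp (X ∩ D)) (esupp Y) ∧ Disjoint (esupp X) (esupp (Y ∩ D)))) := by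
  have hKu : IsUpperSet K := hK ▸ isUpperSet_forcedHull hG _
  have hGK : G ⊆ K := hK ▸ subset_forcedHull hG _
  have hXG : X ∩ G = X ∩ K := hK ▸ sandwich_left hX hY hG hYne hZ
  have hYG : Y ∩ G = Y ∩ K := hK ▸ sandwich_right hX hY hG hXne hZ
  rw [sahiE_four_eq_of_zVia p D hX hY hG hXne hYne hZ K hK] at h0
  have m := fun (A : Set (Set ι)) => (MeasurableSet.of_discrete : MeasurableSet A)
  have e1 : X ∩ (K ∩ D ∩ Y) = K ∩ D ∩ X ∩ Y := by ext ω; simp only [Set.mem_inter_iff]; tauto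
  have e2 : Y ∩ (K ∩ D ∩ X) = K ∩ D ∩ X ∩ Y := by ext ω; simp only [Set.mem_inter_iff]; tauto
  have e3 : K ∩ (D ∩ X ∩ Y) = K ∩ D ∩ X ∩ Y := by ext ω; simp only [Set.mem_inter_iff]; tauto
  have e4 : X ∩ Y ∩ D = D ∩ X ∩ Y := by ext ω; simp only [Set.mem_inter_iff]; tauto
  have e5 : X ∩ (D ∩ Y) = D ∩ X ∩ Y := by ext ω; simp only [Set.mem_inter_iff]; tauto
  have t1 := prodBernoulli_harris p hX ((hKu.inter hD).inter hY) (m _) (m _)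
  have t2 := prodBernoulli_harris p hY ((hKu.inter hD).inter hX) (m _) (m _)
  have t3 := prodBernoulli_harris p hKu ((hD.inter hX).inter hY) (m _) (m _)
  have t5 := prodBernoulli_harris p (hD.inter hX) hY (m _) (m _)
  have t6 := prodBernoulli_harris p hX (hD.inter hY) (m _) (m _)
  rw [e1] at t1; rw [e2] at t2; rw [e3] at t3; rw [e5] at t6
  have t4 : (prodBernoulli p).real G ≤ (prodBernoulli p).real K := measureReal_mono hGK
  have hP : 0 ≤ ((prodBernoulli p).real K - (prodBernoulli p).real G) *
      (((prodBernoulli p).real (D ∩ X ∩ Y) - (prodBernoulli p).real (D ∩ X) * (prodBernoulli p).real Y)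
        + ((prodBernoulli p).real (D ∩ X ∩ Y) - (prodBernoulli p).real X * (prodBernoulli p).real (D ∩ Y))) :=
    mul_nonneg (by linarith) (by linarith)
  have z1 : (prodBernoulli p).real (K ∩ D ∩ X ∩ Y) = (prodBernoulli p).real X * (prodBernoulli p).real (K ∩ D ∩ Y) :=
    by linarith
  have z2 : (prodBernoulli p).real (K ∩ D ∩ X ∩ Y) = (prodBernoulli p).real Y * (prodBernoulli p).real (K ∩ D ∩ X) :=
    by linarith
  have z3 : (prodBernoulli p).real (K ∩ D ∩ X ∩ Y) = (prodBernoulli p).real K * (prodBernoulli p).real (D ∩ X ∩ Y) :=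
    by linarith
  have zP : ((prodBernoulli p).real K - (prodBernoulli p).real G) *
      (((prodBernoulli p).real (D ∩ X ∩ Y) - (prodBernoulli p).real (D ∩ X) * (prodBernoulli p).real Y)
        + ((prodBernoulli p).real (D ∩ X ∩ Y) - (prodBernoulli p).real X * (prodBernoulli p).real (D ∩ Y))) = 0 :=
    by linarith
  have s1 : Y ∩ G ∩ D = K ∩ D ∩ Y := by rw [hYG]; ext ω; simp only [Set.mem_inter_iff]; tauto
  have s2 : X ∩ G ∩ D = K ∩ D ∩ X := by rw [hXG]; ext ω; simp only [Set.mem_inter_iff]; tauto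
  refine ⟨?_, ?_, ?_, ?_⟩
  · rw [s1]
    exact disjoint_esupp_of_real_inter_eq p hp hX ((hKu.inter hD).inter hY) (by rw [e1]; exact z1)
  · rw [s2]
    exact disjoint_esupp_of_real_inter_eq p hp hY ((hKu.inter hD).inter hX) (by rw [e2]; exact z2)
  · rw [e4]
    exact disjoint_esupp_of_real_inter_eq p hp hKu ((hD.inter hX).inter hY) (by rw [e3]; exact z3)
  · rcases mul_eq_zero.1 zP with h4 | h56
    · left
      by_contra hne
      have hne' : (K \ G).Nonempty := by
        by_contra hem
        rw [Set.not_nonempty_iff_eq_empty, Set.sdiff_eq_empty] at hem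
        exact hne (Set.Subset.antisymm hem hGK)
      have := real_pos_of_nonempty p (fun e => Set.mem_Ioo.1 (hp e)) hne'
      rw [measureReal_sdiff hGK (m _)] at this
      linarith
    · right
      have h5 : (prodBernoulli p).real (D ∩ X ∩ Y) = (prodBernoulli p).real (D ∩ X) * (prodBernoulli p).real Y := by
        linarith
      have h6 : (prodBernoulli p).real (D ∩ X ∩ Y) = (prodBernoulli p).real X * (prodBernoulli p).real (D ∩ Y) := by
        linarith
      refine ⟨?_, ?_⟩
      · rw [Set.inter_comm X D]
        exact disjoint_esupp_of_real_inter_eq p hp (hD.inter hX) hY h5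
      · rw [Set.inter_comm Y D]
        exact disjoint_esupp_of_real_inter_eq p hp hX (hD.inter hY) (by rw [e5]; exact h6)

end Core

/-! ### General slots: `E_4 ≥ 0` and (EQ-4) on quadruples with a `Z_3` sub-triple -/

section Slots

variable {ι : Type*} [Fintype ι]

/-- `(∅, B) ∈ Z_2`. [folklore] -/
theorem suppZeroFlag_two_empty_left (B : Set (Set ι)) : SuppZeroFlag 2 ![(∅ : Set (Set ι)), B] := by
  refine ⟨∅, univ, Finset.disjoint_empty_left _, ?_, ?_⟩
  · rw [determinedBy_iff]; intro ω ω' _; simp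
  · rw [determinedBy_iff]; intro ω ω' h
    simp only [coe_univ, Set.inter_univ] at h
    rw [h]

/-- `(∅, B, C) ∈ Z_3` via the pair `(∅, B)`. [folklore] -/
theorem zVia_empty_left (B C : Set (Set ι)) : ZVia ∅ B C := by
  refine ⟨suppZeroFlag_two_empty_left B, ?_, suppZeroFlag_two_empty_left _⟩
  rw [Set.empty_inter]; exact suppZeroFlag_two_empty_left B

omit [Fintype ι] in
/-- The two slots `a.succAbove 0 ≠ a.succAbove 1` of `Fin 3`. [folklore] -/
theorem succAbove_zero_ne_succAbove_one (a : Fin 3) : a.succAbove 0 ≠ a.succAbove 1 :=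
  fun h => absurd (Fin.succAbove_right_injective h) (by decide)

/-- **`Z_4` with an empty member in the zero-flag sub-triple**: if `U_{−m} ∈ Z_3` and the member `U (m.succAbove a)`
is empty then `U ∈ Z_4` (peel slot `m`; every modified triple still contains `∅`). [this work] -/
theorem suppZeroFlag_four_of_empty (U : Fin 4 → Set (Set ι)) (m : Fin 4)
    (hZ : SuppZeroFlag 3 (fun j => U (m.succAbove j))) (a : Fin 3) (ha : U (m.succAbove a) = ∅) :
    SuppZeroFlag 4 U := by
  refine ⟨m, hZ, fun l => ?_⟩
  have hWa : update (fun j => U (m.succAbove j)) l (U (m.succAbove l) ∩ U m) a = ∅ := by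
    by_cases hla : a = l
    · subst hla; rw [update_self, ha, Set.empty_inter]
    · rw [update_of_ne hla, ha]
  refine suppZeroFlag_three_of_zVia_at _ a (a.succAbove 0) (a.succAbove 1) (Fin.succAbove_ne a 0).symm
    (Fin.succAbove_ne a 1).symm (succAbove_zero_ne_succAbove_one a) ?_
  rw [hWa]
  exact zVia_empty_left _ _

/-- **Sahi's `E_4 ≥ 0` on quadruples with a `Z_3` sub-triple** (every `p ∈ [0,1]^ι`): for four increasing events such
that the three events other than `U_m` form a zero flag of order `3`, `0 ≤ E_4(μ_p; 1_{U_0},…,1_{U_3})` — the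
order-four case of Sahi's Conjecture 5 / `MasterFamilyNonneg 4` on such quadruples, proved without any input of
order three. [this work] -/
theorem sahiE_four_ind_nonneg_of_zeroFlagTriple (p : ι → unitInterval) (U : Fin 4 → Set (Set ι))
    (hU : ∀ j, IsUpperSet (U j)) (m : Fin 4) (hZ : SuppZeroFlag 3 (fun j => U (m.succAbove j))) :
    0 ≤ sahiE (bernoulliWeight p) 4 (fun j => ind (U j)) := by
  obtain ⟨i, h1, h2, h3⟩ := (suppZeroFlag_three_iff_exists _).1 hZ
  rcases Set.eq_empty_or_nonempty (U (m.succAbove (i.succAbove 0))) with hX0 | hXne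
  · exact (sahiE_ind_eq_zero_of_suppZeroFlag p (suppZeroFlag_four_of_empty U m hZ _ hX0)).symm.le
  rcases Set.eq_empty_or_nonempty (U (m.succAbove (i.succAbove 1))) with hY0 | hYne
  · exact (sahiE_ind_eq_zero_of_suppZeroFlag p (suppZeroFlag_four_of_empty U m hZ _ hY0)).symm.le
  rw [sahiE_four_reindex _ _ m i]
  exact sahiE_four_nonneg_of_zVia p (U m) (hU _) (hU _) (hU _) (hU _) hXne hYne ⟨h1, h2, h3⟩

/-- **(EQ-4) on quadruples with a `Z_3` sub-triple** (pointwise, `p` in the open cube): for four increasing events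
such that the three events other than `U_m` form a zero flag of order `3`, `E_4(μ_p; 1_U) = 0 ↔ U ∈ Z_4`.
[this work] -/
theorem sahiE_four_ind_eq_zero_iff_of_zeroFlagTriple (p : ι → unitInterval)
    (hp : ∀ e, (p e : ℝ) ∈ Set.Ioo (0 : ℝ) 1) (U : Fin 4 → Set (Set ι)) (hU : ∀ j, IsUpperSet (U j))
    (m : Fin 4) (hZ : SuppZeroFlag 3 (fun j => U (m.succAbove j))) :
    sahiE (bernoulliWeight p) 4 (fun j => ind (U j)) = 0 ↔ SuppZeroFlag 4 U := by
  refine ⟨fun h0 => ?_, fun h => sahiE_ind_eq_zero_of_suppZeroFlag p h⟩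
  obtain ⟨i, h1, h2, h3⟩ := (suppZeroFlag_three_iff_exists _).1 hZ
  rcases Set.eq_empty_or_nonempty (U (m.succAbove (i.succAbove 0))) with hX0 | hXne
  · exact suppZeroFlag_four_of_empty U m hZ _ hX0
  rcases Set.eq_empty_or_nonempty (U (m.succAbove (i.succAbove 1))) with hY0 | hYne
  · exact suppZeroFlag_four_of_empty U m hZ _ hY0
  rw [sahiE_four_reindex _ _ m i] at h0
  set X := U (m.succAbove (i.succAbove 0)) with hXdef
  set Y := U (m.succAbove (i.succAbove 1)) with hYdef
  set G := U (m.succAbove i) with hGdef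
  set D := U m with hDdef
  have hX : IsUpperSet X := hU _; have hY : IsUpperSet Y := hU _
  have hG : IsUpperSet G := hU _; have hD : IsUpperSet D := hU _
  have hZV : ZVia X Y G := ⟨h1, h2, h3⟩
  set K : Set (Set ι) := {ω : Set ι | ω ∪ ↑(esupp X ∪ esupp Y) ∈ G} with hK
  obtain ⟨F1, F2, F3, F4⟩ := supports_of_sahiE_four_eq_zero p hp hX hY hG hD hXne hYne hZV K hK h0
  have hXK : X ∩ G = X ∩ K := sandwich_left hX hY hG hYne hZV
  have hYK : Y ∩ G = Y ∩ K := sandwich_right hX hY hG hXne hZV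
  have dXK : Disjoint (esupp X) (esupp K) := Finset.disjoint_left.2 fun e heX heK =>
    forall_not_affects_forcedHull_left X Y G e (mem_esupp.1 heX) (mem_esupp.1 heK)
  have dYK : Disjoint (esupp Y) (esupp K) := Finset.disjoint_left.2 fun e heY heK =>
    forall_not_affects_forcedHull_right X Y G e (mem_esupp.1 heY) (mem_esupp.1 heK)
  have ne0 : i.succAbove 0 ≠ i := Fin.succAbove_ne i 0; have ne1 : i.succAbove 1 ≠ i := Fin.succAbove_ne i 1
  have ne01 : i.succAbove 0 ≠ i.succAbove 1 := succAbove_zero_ne_succAbove_one i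
  have s1 : X ∩ (G ∩ D) = X ∩ G ∩ D := (Set.inter_assoc _ _ _).symm
  have s2 : Y ∩ (G ∩ D) = Y ∩ G ∩ D := (Set.inter_assoc _ _ _).symm
  have s3 : Y ∩ (X ∩ D) = X ∩ Y ∩ D := by ext ω; simp only [Set.mem_inter_iff]; tauto
  have s4 : G ∩ (X ∩ D) = X ∩ G ∩ D := by ext ω; simp only [Set.mem_inter_iff]; tauto
  have s5 : X ∩ D ∩ G = X ∩ G ∩ D := by ext ω; simp only [Set.mem_inter_iff]; tauto
  have s6 : X ∩ D ∩ Y = X ∩ Y ∩ D := by ext ω; simp only [Set.mem_inter_iff]; tauto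
  have s7 : X ∩ (Y ∩ D) = X ∩ Y ∩ D := (Set.inter_assoc _ _ _).symm
  have s8 : G ∩ (Y ∩ D) = Y ∩ G ∩ D := by ext ω; simp only [Set.mem_inter_iff]; tauto
  have s9 : Y ∩ D ∩ X = X ∩ Y ∩ D := by ext ω; simp only [Set.mem_inter_iff]; tauto
  have s10 : Y ∩ D ∩ G = Y ∩ G ∩ D := by ext ω; simp only [Set.mem_inter_iff]; tauto
  refine ⟨m, hZ, fun l => ?_⟩
  rcases fin_three_eq_or_succAbove l i with hl | hl | hl <;> rw [hl]
  · -- the apex `G` is modified: `(X, Y, G ∩ D)` via `(X, Y)`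
    refine suppZeroFlag_three_of_zVia_at _ (i.succAbove 0) (i.succAbove 1) i ne01 ne0 ne1 ?_
    simp only [update_self, update_of_ne ne0, update_of_ne ne1]
    refine ⟨h1, ?_, ?_⟩
    · rw [s1]; exact (suppZeroFlag_two_iff ((hX.inter hG).inter hD) hY).2 F2.symm
    · rw [s2]; exact (suppZeroFlag_two_iff hX ((hY.inter hG).inter hD)).2 F1
  · -- `X` is modified: `(X ∩ D, Y, G)`
    rcases F4 with hKG | ⟨F5, F6⟩
    · -- `K = G`: via the independent pair `(Y, G)`
      refine suppZeroFlag_three_of_zVia_at _ (i.succAbove 1) i (i.succAbove 0) ne1 ne01.symm ne0.symm ?_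
      simp only [update_self, update_of_ne ne01.symm, update_of_ne ne0.symm]
      refine ⟨?_, ?_, ?_⟩
      · exact (suppZeroFlag_two_iff hY hG).2 (hKG ▸ dYK)
      · rw [s3]; exact (suppZeroFlag_two_iff ((hX.inter hY).inter hD) hG).2 (hKG ▸ F3.symm)
      · rw [s4]; exact (suppZeroFlag_two_iff hY ((hX.inter hG).inter hD)).2 F2
    · -- via the independent pair `(X ∩ D, Y)`
      refine suppZeroFlag_three_of_zVia_at _ (i.succAbove 0) (i.succAbove 1) i ne01 ne0 ne1 ?_
      simp only [update_self, update_of_ne ne01.symm, update_of_ne ne0.symm]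
      refine ⟨(suppZeroFlag_two_iff (hX.inter hD) hY).2 F5, ?_, ?_⟩
      · rw [s5]; exact (suppZeroFlag_two_iff ((hX.inter hG).inter hD) hY).2 F2.symm
      · refine (suppZeroFlag_two_iff (hX.inter hD) (hY.inter hG)).2 (Finset.disjoint_left.2 fun e he heYG => ?_)
        rw [hYK] at heYG
        rcases mem_union.1 (esupp_inter_subset _ _ heYG) with heY | heK
        · exact Finset.disjoint_left.1 F5 he heY
        · have he' := esupp_subset_esupp_inter (hX.inter hD) hY hYne F5 he
          rw [s6] at he'
          exact Finset.disjoint_left.1 F3 heK he'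
  · -- `Y` is modified: `(X, Y ∩ D, G)`
    rcases F4 with hKG | ⟨F5, F6⟩
    · -- `K = G`: via the independent pair `(X, G)`
      refine suppZeroFlag_three_of_zVia_at _ (i.succAbove 0) i (i.succAbove 1) ne0 ne01 ne1.symm ?_
      simp only [update_self, update_of_ne ne01, update_of_ne ne1.symm]
      refine ⟨?_, ?_, ?_⟩
      · exact (suppZeroFlag_two_iff hX hG).2 (hKG ▸ dXK)
      · rw [s7]; exact (suppZeroFlag_two_iff ((hX.inter hY).inter hD) hG).2 (hKG ▸ F3.symm)
      · rw [s8]; exact (suppZeroFlag_two_iff hX ((hY.inter hG).inter hD)).2 F1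
    · -- via the independent pair `(X, Y ∩ D)`
      refine suppZeroFlag_three_of_zVia_at _ (i.succAbove 0) (i.succAbove 1) i ne01 ne0 ne1 ?_
      simp only [update_self, update_of_ne ne01, update_of_ne ne1.symm]
      refine ⟨(suppZeroFlag_two_iff hX (hY.inter hD)).2 F6, ?_, ?_⟩
      · refine (suppZeroFlag_two_iff (hX.inter hG) (hY.inter hD)).2 (Finset.disjoint_left.2 fun e heXG he => ?_)
        rw [hXK] at heXG
        rcases mem_union.1 (esupp_inter_subset _ _ heXG) with heX | heK
        · exact Finset.disjoint_left.1 F6 heX he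
        · have he' := esupp_subset_esupp_inter (hY.inter hD) hX hXne F6.symm he
          rw [s9] at he'
          exact Finset.disjoint_left.1 F3 heK he'
      · rw [s10]; exact (suppZeroFlag_two_iff hX ((hY.inter hG).inter hD)).2 F1

end Slots

/-! ### Consequences for the master statements of order four -/

/-- **`MasterFamilyEqIff 4` ⟺ "an interior zero of `E_4` forces a `Z_3` sub-triple".** [this work] -/
theorem masterFamilyEqIff_four_iff :
    MasterFamilyEqIff 4 ↔ ∀ (ι : Type) [Fintype ι] (p : ι → unitInterval), (∀ e, (p e : ℝ) ∈ Set.Ioo (0 : ℝ) 1) →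
      ∀ U : Fin 4 → Set (Set ι), (∀ j, IsUpperSet (U j)) →
        sahiE (bernoulliWeight p) 4 (fun j => ind (U j)) = 0 →
          ∃ m : Fin 4, SuppZeroFlag 3 (fun j => U (m.succAbove j)) := by
  refine ⟨fun hE ι _ p hp U hU h0 => ?_, fun hH ι _ p hp U hU => ⟨fun h0 => ?_, masterFamilyEqIff_mpr 4 ι p U⟩⟩
  · obtain ⟨m, hm, -⟩ := (hE ι p hp U hU).1 h0
    exact ⟨m, hm⟩
  · obtain ⟨m, hm⟩ := hH ι p hp U hU h0
    exact (sahiE_four_ind_eq_zero_iff_of_zeroFlagTriple p hp U hU m hm).1 h0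

/-- **(EQI-4) ⟺ (T₄)**: the identically-zero form `MasterFamilyIdentEqIff 4` is equivalent to "four increasing events
with NO `Z_3` sub-triple have `E_4(μ_p) ≠ 0` for some interior `p`" — quadruples with a `Z_3` sub-triple are
settled by `sahiE_four_ind_eq_zero_iff_of_zeroFlagTriple`. [this work] -/
theorem masterFamilyIdentEqIff_four_iff :
    MasterFamilyIdentEqIff 4 ↔ ∀ (ι : Type) [Fintype ι] (U : Fin 4 → Set (Set ι)), (∀ j, IsUpperSet (U j)) →
      (∀ m : Fin 4, ¬ SuppZeroFlag 3 (fun j => U (m.succAbove j))) →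
        ∃ p : ι → unitInterval, (∀ e, (p e : ℝ) ∈ Set.Ioo (0 : ℝ) 1) ∧
          sahiE (bernoulliWeight p) 4 (fun j => ind (U j)) ≠ 0 := by
  constructor
  · intro hI ι _ U hU hno
    by_contra hall
    push Not at hall
    obtain ⟨m, hm, -⟩ := (hI ι U hU).1 fun p hp => hall p hp
    exact hno m hm
  · intro hT ι _ U hU
    refine ⟨fun hall => ?_, fun hZ p _ => masterFamilyIdentEqIff_mpr 4 ι U hZ p⟩
    by_cases hex : ∃ m : Fin 4, SuppZeroFlag 3 (fun j => U (m.succAbove j))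
    · obtain ⟨m, hm⟩ := hex
      exact (sahiE_four_ind_eq_zero_iff_of_zeroFlagTriple (halfParams ι) (halfParams_mem_Ioo ι) U hU m hm).1
        (hall _ (halfParams_mem_Ioo ι))
    · push Not at hex
      obtain ⟨p, hp, hne⟩ := hT ι U hU hex
      exact absurd (hall p hp) hne

end Summit.CriticalPhenomena.PercolationContinuityZ3.Theorems
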